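import Mathlib.Analysis.Calculus.ParametricIntegral
import Mathlib.Analysis.Calculus.MeanValue
import Mathlib.Analysis.Calculus.ContDiff.RCLike
import Mathlib.MeasureTheory.Integral.Bochner.ContinuousLinearMap
import Mathlib.MeasureTheory.Function.L2Space
import Literature.Analysis.FluidPDE.VortexFilament.Curve
import Literature.Analysis.FluidPDE.VortexFilament.LayerCake

/-!
# The test field `ξ = F ∗ μ_Γ` of a closed Lipschitz curve

Support file for the proof of the Jerrard–Seis energy lower bound
(`Literature.Analysis.FluidPDE.VortexFilament.JerrardSeis2016_filamentEnergyLowerBound`).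
For a kernel `F : ℝ³ → ℝ` and an arclength loop `γ` of period `L`, the test field is
`ξ(x) = ∫_{[0,L)} F(x − γ(s)) γ'(s) ds` (the vector potential `Φ^ε = G ∗ ρ^ε ∗ μ_Γ` of
[JerrardSeis2016, §4.3] with `G ∗ ρ^ε` replaced by the explicit kernel of `Kernel.lean`). No
definition is introduced: `ξ` enters the statements through the hypothesis
`hξ : ξ = fun x => ∫ s in Ico 0 L, F (x - γ s) • deriv γ s`.

## Contents

* Smearing calculus for `x ↦ ∫_{[0,L)} ψ(s) Φ(x − γ(s)) ds` with `Φ` continuous (resp. `C¹`)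
  of compact support and `|ψ| ≤ 1`: continuity (dominated convergence), differentiation under
  the integral (`hasFDerivAt_integral_of_dominated_of_fderiv_le`), `C¹` regularity, compact
  support, pointwise bounds.
* The test field: components are smears (`testField_apply`), `ξ ∈ C¹_c` (`contDiff_one_testField`,
  `hasCompactSupport_testField`), the Jacobian entries are bounded by `∫ |∇F(x − γ(s))| ds` and
  `|curl ξ(x)| ≤ 6 ∫ |∇F(x − γ(s))| ds` (`norm_curl_testField_le`).
* Layer cake (a): `∫_{[0,L)} max(ε, |x − γ(s)|)^{-2} ds ≤ 48 K/ε` from Jerrard–Seis' Lemma 4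
  (`IsArclengthLoop.integral_inv_sq_le`), whence, for kernels with
  `|∇F(z)| ≤ C_g max(ε,|z|)^{-2}`: `‖curl ξ‖_∞ ≤ 288 C_g K/ε` (`norm_curl_testField_le_const`, the
  analogue of [JerrardSeis2016, Prop. 1 (ve.1), q = ∞]) and the small-translation bound
  `|ξ(c + z) − ξ(c)| ≤ 192 C_g K` for `|z| ≤ ε` (`norm_testField_sub_le`, mean value inequality).
-/

noncomputable section

open MeasureTheory Set Filter Function Metric
open scoped Topology InnerProductSpace RealInnerProductSpace ENNReal NNReal

namespace Literature.Analysis.FluidPDE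

namespace VortexFilament

/-! ### Smearing a kernel along the curve: `x ↦ ∫_{[0,L)} ψ(s) Φ(x − γ(s)) ds` -/

section Smear

variable {L : ℝ} {γ : ℝ → EuclideanSpace ℝ (Fin 3)} {V : Type*} [NormedAddCommGroup V]
  [NormedSpace ℝ V]

omit [NormedSpace ℝ V] in
/-- A continuous compactly supported function is bounded. [folklore] -/
theorem exists_bound_of_continuous_hasCompactSupport {Φ : EuclideanSpace ℝ (Fin 3) → V}
    (hΦc : Continuous Φ) (hΦs : HasCompactSupport Φ) : ∃ C, 0 ≤ C ∧ ∀ z, ‖Φ z‖ ≤ C := by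
  obtain ⟨C, hC⟩ := hΦs.exists_bound_of_continuous hΦc
  exact ⟨max C 0, le_max_right _ _, fun z => (hC z).trans (le_max_left _ _)⟩

/-- Measurability of the smeared integrand in the parameter. [folklore] -/
theorem aestronglyMeasurable_smear_integrand (hγc : Continuous γ) {Φ : EuclideanSpace ℝ (Fin 3) → V}
    (hΦc : Continuous Φ) {ψ : ℝ → ℝ} (hψm : Measurable ψ) (x : EuclideanSpace ℝ (Fin 3))
    (μ : Measure ℝ) :
    AEStronglyMeasurable (fun s => ψ s • Φ (x - γ s)) μ :=
  (hψm.aestronglyMeasurable.smul (hΦc.comp (continuous_const.sub hγc)).aestronglyMeasurable)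

/-- Integrability of the smeared integrand on a period. [folklore] -/
theorem integrable_smear_integrand (hγc : Continuous γ) {Φ : EuclideanSpace ℝ (Fin 3) → V}
    (hΦc : Continuous Φ) (hΦs : HasCompactSupport Φ) {ψ : ℝ → ℝ} (hψm : Measurable ψ)
    (hψb : ∀ s, |ψ s| ≤ 1) (x : EuclideanSpace ℝ (Fin 3)) :
    Integrable (fun s => ψ s • Φ (x - γ s)) (volume.restrict (Ico 0 L)) := by
  obtain ⟨C, hC0, hC⟩ := exists_bound_of_continuous_hasCompactSupport hΦc hΦs
  refine Integrable.of_bound (aestronglyMeasurable_smear_integrand hγc hΦc hψm x _) C ?_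
  refine ae_of_all _ fun s => ?_
  rw [norm_smul, Real.norm_eq_abs]
  calc |ψ s| * ‖Φ (x - γ s)‖ ≤ 1 * C := mul_le_mul (hψb s) (hC _) (norm_nonneg _) zero_le_one
    _ = C := one_mul _

/-- **Continuity of a smeared kernel** `x ↦ ∫_{[0,L)} ψ(s) Φ(x − γ(s)) ds` for `Φ` continuous
with compact support and `|ψ| ≤ 1` (dominated convergence). [folklore] -/
theorem continuous_smear [CompleteSpace V] (hγc : Continuous γ)
    {Φ : EuclideanSpace ℝ (Fin 3) → V} (hΦc : Continuous Φ) (hΦs : HasCompactSupport Φ)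
    {ψ : ℝ → ℝ} (hψm : Measurable ψ) (hψb : ∀ s, |ψ s| ≤ 1) :
    Continuous fun x : EuclideanSpace ℝ (Fin 3) => ∫ s in Ico 0 L, ψ s • Φ (x - γ s) := by
  obtain ⟨C, hC0, hC⟩ := exists_bound_of_continuous_hasCompactSupport hΦc hΦs
  refine continuous_of_dominated (bound := fun _ => C)
    (fun x => aestronglyMeasurable_smear_integrand hγc hΦc hψm x _) ?_ (integrable_const C) ?_
  · intro x
    refine ae_of_all _ fun s => ?_
    rw [norm_smul, Real.norm_eq_abs]
    calc |ψ s| * ‖Φ (x - γ s)‖ ≤ 1 * C := mul_le_mul (hψb s) (hC _) (norm_nonneg _) zero_le_one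
      _ = C := one_mul _
  · exact ae_of_all _ fun s => (hΦc.comp (continuous_id.sub continuous_const)).const_smul _

/-- **Differentiation under the integral** for a smeared `C¹` kernel with compact support:
`∇_x ∫ ψ(s) Φ(x − γ(s)) ds = ∫ ψ(s) ∇Φ(x − γ(s)) ds`. [folklore] -/
theorem hasFDerivAt_smear (hγc : Continuous γ) {Φ : EuclideanSpace ℝ (Fin 3) → ℝ}
    (hΦ : ContDiff ℝ 1 Φ) (hΦs : HasCompactSupport Φ) {ψ : ℝ → ℝ} (hψm : Measurable ψ)
    (hψb : ∀ s, |ψ s| ≤ 1) (x : EuclideanSpace ℝ (Fin 3)) :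
    HasFDerivAt (fun x : EuclideanSpace ℝ (Fin 3) => ∫ s in Ico 0 L, ψ s • Φ (x - γ s))
      (∫ s in Ico 0 L, ψ s • fderiv ℝ Φ (x - γ s)) x := by
  have hΦc : Continuous Φ := hΦ.continuous
  have hΦ'c : Continuous (fderiv ℝ Φ) := hΦ.continuous_fderiv one_ne_zero
  have hΦ's : HasCompactSupport (fderiv ℝ Φ) := hΦs.fderiv ℝ
  obtain ⟨C, hC0, hC⟩ := exists_bound_of_continuous_hasCompactSupport hΦ'c hΦ's
  have hdiff : ∀ s (y : EuclideanSpace ℝ (Fin 3)),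
      HasFDerivAt (fun y : EuclideanSpace ℝ (Fin 3) => ψ s • Φ (y - γ s))
        (ψ s • fderiv ℝ Φ (y - γ s)) y := by
    intro s y
    have h1 : HasFDerivAt (fun y : EuclideanSpace ℝ (Fin 3) => Φ (y - γ s))
        (fderiv ℝ Φ (y - γ s)) y := by
      have h0 := ((hΦ.differentiable one_ne_zero) (y - γ s)).hasFDerivAt.comp y
        ((hasFDerivAt_id y).sub_const (γ s))
      rw [ContinuousLinearMap.comp_id] at h0
      exact h0
    exact h1.const_smul (ψ s)
  refine hasFDerivAt_integral_of_dominated_of_fderiv_le (μ := volume.restrict (Ico 0 L))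
    (F := fun (y : EuclideanSpace ℝ (Fin 3)) s => ψ s • Φ (y - γ s))
    (F' := fun (y : EuclideanSpace ℝ (Fin 3)) s => ψ s • fderiv ℝ Φ (y - γ s)) (x₀ := x)
    (bound := fun _ => C) (s := univ) univ_mem ?_ ?_ ?_ ?_ ?_ ?_
  · exact Eventually.of_forall fun y => aestronglyMeasurable_smear_integrand hγc hΦc hψm y _
  · exact integrable_smear_integrand hγc hΦc hΦs hψm hψb x
  · exact aestronglyMeasurable_smear_integrand hγc hΦ'c hψm x _
  · refine ae_of_all _ fun s y _ => ?_
    rw [norm_smul, Real.norm_eq_abs]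
    calc |ψ s| * ‖fderiv ℝ Φ (y - γ s)‖ ≤ 1 * C :=
          mul_le_mul (hψb s) (hC _) (norm_nonneg _) zero_le_one
      _ = C := one_mul _
  · exact integrable_const C
  · exact ae_of_all _ fun s y _ => hdiff s y

/-- A smeared `C¹` kernel with compact support is `C¹`. [folklore] -/
theorem contDiff_one_smear (hγc : Continuous γ) {Φ : EuclideanSpace ℝ (Fin 3) → ℝ}
    (hΦ : ContDiff ℝ 1 Φ) (hΦs : HasCompactSupport Φ) {ψ : ℝ → ℝ} (hψm : Measurable ψ)
    (hψb : ∀ s, |ψ s| ≤ 1) :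
    ContDiff ℝ 1 fun x : EuclideanSpace ℝ (Fin 3) => ∫ s in Ico 0 L, ψ s • Φ (x - γ s) := by
  rw [contDiff_one_iff_fderiv]
  refine ⟨fun x => (hasFDerivAt_smear hγc hΦ hΦs hψm hψb x).differentiableAt, ?_⟩
  have : fderiv ℝ (fun x : EuclideanSpace ℝ (Fin 3) => ∫ s in Ico 0 L, ψ s • Φ (x - γ s)) =
      fun x => ∫ s in Ico 0 L, ψ s • fderiv ℝ Φ (x - γ s) :=
    funext fun x => (hasFDerivAt_smear hγc hΦ hΦs hψm hψb x).fderiv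
  rw [this]
  exact continuous_smear hγc (hΦ.continuous_fderiv one_ne_zero) (hΦs.fderiv ℝ) hψm hψb

/-- The smeared kernel vanishes far away: if `Φ = 0` outside the ball of radius `R` and
`|γ| ≤ M` on `[0, L)`, then the smear vanishes for `|x| > M + R`. [folklore] -/
theorem smear_eq_zero_of_far {Φ : EuclideanSpace ℝ (Fin 3) → V} {R M : ℝ}
    (hΦR : ∀ z, R < ‖z‖ → Φ z = 0) (hM : ∀ s ∈ Ico (0:ℝ) L, ‖γ s‖ ≤ M) (ψ : ℝ → ℝ)
    {x : EuclideanSpace ℝ (Fin 3)} (hx : M + R < ‖x‖) :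
    ∫ s in Ico 0 L, ψ s • Φ (x - γ s) = 0 := by
  refine setIntegral_eq_zero_of_forall_eq_zero fun s hs => ?_
  rw [hΦR _ ?_, smul_zero]
  calc R < ‖x‖ - M := by linarith
    _ ≤ ‖x‖ - ‖γ s‖ := by linarith [hM s hs]
    _ ≤ ‖x - γ s‖ := norm_sub_norm_le x (γ s)

/-- Hence a smeared compactly supported kernel has compact support (for `γ` bounded on the
period). [folklore] -/
theorem hasCompactSupport_smear {Φ : EuclideanSpace ℝ (Fin 3) → V} {R M : ℝ}
    (hΦR : ∀ z, R < ‖z‖ → Φ z = 0) (hM : ∀ s ∈ Ico (0:ℝ) L, ‖γ s‖ ≤ M) (ψ : ℝ → ℝ) :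
    HasCompactSupport fun x : EuclideanSpace ℝ (Fin 3) => ∫ s in Ico 0 L, ψ s • Φ (x - γ s) := by
  refine HasCompactSupport.intro (isCompact_closedBall (0 : EuclideanSpace ℝ (Fin 3)) (M + R)) ?_
  intro x hx
  rw [mem_closedBall_zero_iff, not_le] at hx
  exact smear_eq_zero_of_far hΦR hM ψ hx

/-- Pointwise bound of a smear by the smear of a pointwise bound. [folklore] -/
theorem norm_smear_le (hγc : Continuous γ) {Φ : EuclideanSpace ℝ (Fin 3) → V}
    {g : EuclideanSpace ℝ (Fin 3) → ℝ} (hg : ∀ z, ‖Φ z‖ ≤ g z) (hgc : Continuous g)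
    {ψ : ℝ → ℝ} (hψb : ∀ s, |ψ s| ≤ 1) (x : EuclideanSpace ℝ (Fin 3)) :
    ‖∫ s in Ico 0 L, ψ s • Φ (x - γ s)‖ ≤ ∫ s in Ico 0 L, g (x - γ s) := by
  refine (norm_integral_le_integral_norm _).trans (integral_mono_of_nonneg ?_ ?_ ?_)
  · exact ae_of_all _ fun _ => norm_nonneg _
  · have hgc' : Continuous fun s => g (x - γ s) := hgc.comp (continuous_const.sub hγc)
    exact (hgc'.integrableOn_Icc (a := 0) (b := L)).mono_set Ico_subset_Icc_self
  · refine ae_of_all _ fun s => ?_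
    show ‖ψ s • Φ (x - γ s)‖ ≤ g (x - γ s)
    rw [norm_smul, Real.norm_eq_abs]
    calc |ψ s| * ‖Φ (x - γ s)‖ ≤ 1 * g (x - γ s) :=
          mul_le_mul (hψb s) (hg _) (norm_nonneg _) zero_le_one
      _ = g (x - γ s) := one_mul _

end Smear

/-! ### The test field `ξ(x) = ∫_{[0,L)} F(x − γ(s)) γ'(s) ds` -/

section TestField

variable {L : ℝ} {γ : ℝ → EuclideanSpace ℝ (Fin 3)}

/-- The components of the tangent `γ'` are measurable and bounded by `1`. [folklore] -/
theorem IsArclengthLoop.measurable_deriv_apply (hγ : IsArclengthLoop L γ) (k : Fin 3) :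
    Measurable (fun s => deriv γ s k) ∧ ∀ s, |deriv γ s k| ≤ 1 := by
  refine ⟨(EuclideanSpace.proj k).continuous.measurable.comp (_root_.measurable_deriv γ),
    fun s => ?_⟩
  have h := PiLp.norm_apply_le (deriv γ s) k
  rw [Real.norm_eq_abs] at h
  exact h.trans (hγ.norm_deriv_le_one s)

/-- `γ` is bounded on a period. [folklore] -/
theorem IsArclengthLoop.exists_bound (hγ : IsArclengthLoop L γ) :
    ∃ M : ℝ, ∀ s ∈ Ico (0:ℝ) L, ‖γ s‖ ≤ M := by
  obtain ⟨M, hM⟩ := isCompact_Icc.exists_bound_of_continuousOn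
    (hγ.lipschitz.continuous.continuousOn (s := Icc (0:ℝ) L))
  exact ⟨M, fun s hs => hM s (Ico_subset_Icc_self hs)⟩

/-- Integrability of the vector integrand `F(x − γ s) γ'(s)` on a period. [folklore] -/
theorem integrable_testField_integrand (hγ : IsArclengthLoop L γ)
    {F : EuclideanSpace ℝ (Fin 3) → ℝ} (hFc : Continuous F) (hFs : HasCompactSupport F)
    (x : EuclideanSpace ℝ (Fin 3)) :
    Integrable (fun s => F (x - γ s) • deriv γ s) (volume.restrict (Ico 0 L)) := by
  obtain ⟨C, hC0, hC⟩ := exists_bound_of_continuous_hasCompactSupport hFc hFs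
  have hmeas : AEStronglyMeasurable (fun s => F (x - γ s) • deriv γ s)
      (volume.restrict (Ico 0 L)) :=
    ((hFc.comp (continuous_const.sub hγ.lipschitz.continuous)).aestronglyMeasurable.smul
      (_root_.measurable_deriv γ).aestronglyMeasurable)
  refine Integrable.of_bound hmeas C (ae_of_all _ fun s => ?_)
  rw [norm_smul]
  calc ‖F (x - γ s)‖ * ‖deriv γ s‖ ≤ C * 1 :=
        mul_le_mul (hC _) (hγ.norm_deriv_le_one s) (norm_nonneg _) hC0
    _ = C := mul_one _

/-- **Components of the test field** are scalar smears:
`ξ(x)_k = ∫ γ'_k(s) F(x − γ(s)) ds`. [folklore] -/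
theorem testField_apply (hγ : IsArclengthLoop L γ) {F : EuclideanSpace ℝ (Fin 3) → ℝ}
    (hFc : Continuous F) (hFs : HasCompactSupport F) (x : EuclideanSpace ℝ (Fin 3)) (k : Fin 3) :
    (∫ s in Ico 0 L, F (x - γ s) • deriv γ s) k = ∫ s in Ico 0 L, (deriv γ s k) • F (x - γ s) := by
  have hint := integrable_testField_integrand hγ hFc hFs x
  have h := ((EuclideanSpace.proj k : EuclideanSpace ℝ (Fin 3) →L[ℝ] ℝ).integral_comp_comm hint)
  simp only [PiLp.proj_apply, PiLp.smul_apply, smul_eq_mul] at h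
  rw [← h]
  congr 1
  funext s
  ring

/-- **The test field is `C¹`.** [folklore] -/
theorem contDiff_one_testField (hγ : IsArclengthLoop L γ) {F : EuclideanSpace ℝ (Fin 3) → ℝ}
    (hF : ContDiff ℝ 1 F) (hFs : HasCompactSupport F) {ξ : EuclideanSpace ℝ (Fin 3) → EuclideanSpace ℝ (Fin 3)}
    (hξ : ξ = fun x => ∫ s in Ico 0 L, F (x - γ s) • deriv γ s) : ContDiff ℝ 1 ξ := by
  rw [contDiff_euclidean]
  intro k
  have : (fun x => ξ x k) = fun x => ∫ s in Ico 0 L, (deriv γ s k) • F (x - γ s) := by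
    funext x; rw [hξ]; exact testField_apply hγ hF.continuous hFs x k
  rw [this]
  obtain ⟨hm, hb⟩ := hγ.measurable_deriv_apply k
  exact contDiff_one_smear hγ.lipschitz.continuous hF hFs hm hb

/-- **The test field has compact support.** [folklore] -/
theorem hasCompactSupport_testField (hγ : IsArclengthLoop L γ)
    {F : EuclideanSpace ℝ (Fin 3) → ℝ} {R : ℝ} (hFR : ∀ z, R ≤ ‖z‖ → F z = 0)
    {ξ : EuclideanSpace ℝ (Fin 3) → EuclideanSpace ℝ (Fin 3)}
    (hξ : ξ = fun x => ∫ s in Ico 0 L, F (x - γ s) • deriv γ s) : HasCompactSupport ξ := by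
  obtain ⟨M, hM⟩ := hγ.exists_bound
  rw [hξ]
  refine HasCompactSupport.intro (isCompact_closedBall (0 : EuclideanSpace ℝ (Fin 3)) (M + R)) ?_
  intro x hx
  rw [mem_closedBall_zero_iff, not_le] at hx
  refine setIntegral_eq_zero_of_forall_eq_zero fun s hs => ?_
  rw [hFR _ ?_, zero_smul]
  calc R ≤ ‖x‖ - M := by linarith
    _ ≤ ‖x‖ - ‖γ s‖ := by linarith [hM s hs]
    _ ≤ ‖x - γ s‖ := norm_sub_norm_le x (γ s)

/-- The partial derivatives of the test field: `∂_j ξ_k(x) = ∫ γ'_k(s) ∂_jF(x − γ(s)) ds`, and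
the derivative of `x ↦ ξ(x)_k` is the smear of `∇F`. [folklore] -/
theorem hasFDerivAt_testField_apply (hγ : IsArclengthLoop L γ)
    {F : EuclideanSpace ℝ (Fin 3) → ℝ} (hF : ContDiff ℝ 1 F) (hFs : HasCompactSupport F)
    {ξ : EuclideanSpace ℝ (Fin 3) → EuclideanSpace ℝ (Fin 3)}
    (hξ : ξ = fun x => ∫ s in Ico 0 L, F (x - γ s) • deriv γ s) (x : EuclideanSpace ℝ (Fin 3))
    (k : Fin 3) :
    HasFDerivAt (fun x => ξ x k) (∫ s in Ico 0 L, (deriv γ s k) • fderiv ℝ F (x - γ s)) x := by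
  have : (fun x => ξ x k) = fun x => ∫ s in Ico 0 L, (deriv γ s k) • F (x - γ s) := by
    funext x; rw [hξ]; exact testField_apply hγ hF.continuous hFs x k
  rw [this]
  obtain ⟨hm, hb⟩ := hγ.measurable_deriv_apply k
  exact hasFDerivAt_smear hγ.lipschitz.continuous hF hFs hm hb x

/-- Entries of the Jacobian of the test field are bounded by the smear of `|∇F|`:
`|∂_j ξ_k(x)| ≤ ∫ |∇F(x − γ(s))| ds`. [folklore] -/
theorem abs_fderiv_testField_apply_le (hγ : IsArclengthLoop L γ)
    {F : EuclideanSpace ℝ (Fin 3) → ℝ} (hF : ContDiff ℝ 1 F) (hFs : HasCompactSupport F)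
    {ξ : EuclideanSpace ℝ (Fin 3) → EuclideanSpace ℝ (Fin 3)}
    (hξ : ξ = fun x => ∫ s in Ico 0 L, F (x - γ s) • deriv γ s) (x : EuclideanSpace ℝ (Fin 3))
    (j k : Fin 3) :
    |fderiv ℝ ξ x (EuclideanSpace.single j 1) k| ≤ ∫ s in Ico 0 L, ‖fderiv ℝ F (x - γ s)‖ := by
  have hdiff : DifferentiableAt ℝ ξ x :=
    ((contDiff_one_testField hγ hF hFs hξ).differentiable one_ne_zero) x
  have hk := hasFDerivAt_testField_apply hγ hF hFs hξ x k
  -- the `k`-th component of `fderiv ξ x v` is `fderiv (ξ · k) x v`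
  have hcomp : fderiv ℝ ξ x (EuclideanSpace.single j 1) k =
      (∫ s in Ico 0 L, (deriv γ s k) • fderiv ℝ F (x - γ s)) (EuclideanSpace.single j 1) := by
    have h1 := ((EuclideanSpace.proj k : EuclideanSpace ℝ (Fin 3) →L[ℝ] ℝ).hasFDerivAt.comp x
      hdiff.hasFDerivAt)
    have h2 : HasFDerivAt (fun x => ξ x k)
        ((EuclideanSpace.proj k : EuclideanSpace ℝ (Fin 3) →L[ℝ] ℝ).comp (fderiv ℝ ξ x)) x := h1
    rw [hk.unique h2]
    rfl
  rw [hcomp]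
  obtain ⟨hm, hb⟩ := hγ.measurable_deriv_apply k
  calc |(∫ s in Ico 0 L, (deriv γ s k) • fderiv ℝ F (x - γ s)) (EuclideanSpace.single j 1)|
      ≤ ‖∫ s in Ico 0 L, (deriv γ s k) • fderiv ℝ F (x - γ s)‖ * ‖EuclideanSpace.single j (1:ℝ)‖ := by
        rw [← Real.norm_eq_abs]; exact ContinuousLinearMap.le_opNorm _ _
    _ = ‖∫ s in Ico 0 L, (deriv γ s k) • fderiv ℝ F (x - γ s)‖ := by simp
    _ ≤ ∫ s in Ico 0 L, ‖fderiv ℝ F (x - γ s)‖ :=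
        norm_smear_le hγ.lipschitz.continuous (fun z => le_rfl)
          (hF.continuous_fderiv one_ne_zero).norm hb x

/-- `‖(a, b, c)‖ ≤ |a| + |b| + |c|` in `ℝ³`. [folklore] -/
theorem norm_toLp_three_le (a b c : ℝ) :
    ‖(WithLp.toLp 2 ![a, b, c] : EuclideanSpace ℝ (Fin 3))‖ ≤ |a| + |b| + |c| := by
  rw [EuclideanSpace.norm_eq]
  simp only [Fin.sum_univ_three]
  rw [Real.sqrt_le_left (by positivity)]
  simp only [Real.norm_eq_abs]
  have ha := abs_nonneg a; have hb := abs_nonneg b; have hc := abs_nonneg c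
  simp only [Matrix.cons_val_zero, Matrix.cons_val_one, Matrix.cons_val]
  nlinarith [sq_abs a, sq_abs b, sq_abs c]

/-- **Pointwise curl bound.** `|curl ξ(x)| ≤ 6 ∫ |∇F(x − γ(s))| ds`. [folklore] -/
theorem norm_curl_testField_le (hγ : IsArclengthLoop L γ)
    {F : EuclideanSpace ℝ (Fin 3) → ℝ} (hF : ContDiff ℝ 1 F) (hFs : HasCompactSupport F)
    {ξ : EuclideanSpace ℝ (Fin 3) → EuclideanSpace ℝ (Fin 3)}
    (hξ : ξ = fun x => ∫ s in Ico 0 L, F (x - γ s) • deriv γ s) (x : EuclideanSpace ℝ (Fin 3)) :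
    ‖curl ξ x‖ ≤ 6 * ∫ s in Ico 0 L, ‖fderiv ℝ F (x - γ s)‖ := by
  have h := abs_fderiv_testField_apply_le hγ hF hFs hξ x
  set I := ∫ s in Ico 0 L, ‖fderiv ℝ F (x - γ s)‖ with hI
  unfold curl
  refine (norm_toLp_three_le _ _ _).trans ?_
  have e1 := h 1 2; have e2 := h 2 1; have e3 := h 2 0; have e4 := h 0 2
  have e5 := h 0 1; have e6 := h 1 0
  calc |fderiv ℝ ξ x (EuclideanSpace.single 1 1) 2 - fderiv ℝ ξ x (EuclideanSpace.single 2 1) 1| +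
        |fderiv ℝ ξ x (EuclideanSpace.single 2 1) 0 - fderiv ℝ ξ x (EuclideanSpace.single 0 1) 2| +
        |fderiv ℝ ξ x (EuclideanSpace.single 0 1) 1 - fderiv ℝ ξ x (EuclideanSpace.single 1 1) 0|
      ≤ (I + I) + (I + I) + (I + I) := by
        gcongr <;> exact (abs_sub _ _).trans (add_le_add (by assumption) (by assumption))
    _ = 6 * I := by ring

/-- **Layer cake (a).** For an arclength loop with `‖κ*‖_{L^{1,∞}} ≤ K`,
`∫_{[0,L)} max(ε, |x − γ(s)|)^{-2} ds ≤ 48 K/ε` for every `x` and `ε > 0`: the level sets are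
controlled by Jerrard–Seis' Lemma 4 and have a `t^{-1/2}` tail. [cite: JerrardSeis2016, §4.1 Lemma 4 (consequence)] -/
theorem IsArclengthLoop.integral_inv_sq_le (hγ : IsArclengthLoop L γ) {K : ℝ≥0}
    (hK : weakL1Norm L (kappaStar L γ) ≤ K) {ε : ℝ} (hε : 0 < ε) (x : EuclideanSpace ℝ (Fin 3)) :
    ∫ s in Ico 0 L, ((max ε ‖x - γ s‖)⁻¹) ^ 2 ≤ 48 * K / ε := by
  have hK0 : (0:ℝ) ≤ K := K.2
  have hmeas : Measurable fun s => ((max ε ‖x - γ s‖)⁻¹) ^ 2 :=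
    ((continuous_const.max (continuous_const.sub hγ.lipschitz.continuous).norm).inv₀
      (fun s => (lt_max_of_lt_left hε).ne')).pow 2 |>.measurable
  have h := integral_le_of_meas_lt_le_rpow_neg_half (μ := volume.restrict (Ico (0:ℝ) L))
    (G := fun s => ((max ε ‖x - γ s‖)⁻¹) ^ 2) (T := ε⁻¹ ^ 2) (c := 24 * K) (by positivity)
    (by positivity) (fun s => by positivity) ?_ hmeas.aemeasurable ?_
  · calc ∫ s in Ico 0 L, ((max ε ‖x - γ s‖)⁻¹) ^ 2 ≤ 2 * (24 * K) * Real.sqrt (ε⁻¹ ^ 2) := h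
      _ = 48 * K / ε := by rw [Real.sqrt_sq (inv_nonneg.2 hε.le)]; ring
  · intro s
    gcongr
    exact le_max_left _ _
  · intro t ht _
    have hr : 0 < t ^ (-(1/2 : ℝ)) := Real.rpow_pos_of_pos ht _
    rw [Measure.restrict_apply' measurableSet_Ico]
    calc volume ({s | t < ((max ε ‖x - γ s‖)⁻¹) ^ 2} ∩ Ico 0 L)
        ≤ volume {s : ℝ | s ∈ Ico 0 L ∧ ‖γ s - x‖ < t ^ (-(1/2 : ℝ))} := by
          refine measure_mono fun s hs => ⟨hs.2, ?_⟩
          have h1 : t < ((max ε ‖x - γ s‖)⁻¹) ^ 2 := hs.1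
          have hm : 0 < max ε ‖x - γ s‖ := lt_max_of_lt_left hε
          rw [norm_sub_rev]
          refine lt_of_le_of_lt (le_max_right ε _) ?_
          -- `max < t^{-1/2}` iff `t < max⁻²`
          have h2 : t ^ (-(1/2 : ℝ)) = (Real.sqrt t)⁻¹ := by
            rw [Real.sqrt_eq_rpow, ← Real.rpow_neg ht.le]
          rw [h2, lt_inv_comm₀ hm (Real.sqrt_pos.2 ht), Real.sqrt_lt' (inv_pos.2 hm)]
          simpa [inv_pow] using h1
      _ ≤ ENNReal.ofReal (24 * t ^ (-(1/2 : ℝ)) * K) := hγ.volume_near_le hK x hr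
      _ = ENNReal.ofReal (24 * K * t ^ (-(1/2 : ℝ))) := by ring_nf

/-- **Curl bound for the test field** with a kernel whose gradient satisfies
`|∇F(z)| ≤ C_g / max(ε,|z|)²`: `|curl ξ(x)| ≤ 288 C_g K / ε` everywhere. [cite: JerrardSeis2016, Prop 1 (ve.1) with q = ∞ (analogue)] -/
theorem norm_curl_testField_le_const (hγ : IsArclengthLoop L γ) {K : ℝ≥0}
    (hK : weakL1Norm L (kappaStar L γ) ≤ K) {ε Cg : ℝ} (hε : 0 < ε) (hCg : 0 ≤ Cg)
    {F : EuclideanSpace ℝ (Fin 3) → ℝ} (hF : ContDiff ℝ 1 F) (hFs : HasCompactSupport F)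
    (hgrad : ∀ z, ‖fderiv ℝ F z‖ ≤ Cg * ((max ε ‖z‖)⁻¹) ^ 2)
    {ξ : EuclideanSpace ℝ (Fin 3) → EuclideanSpace ℝ (Fin 3)}
    (hξ : ξ = fun x => ∫ s in Ico 0 L, F (x - γ s) • deriv γ s) (x : EuclideanSpace ℝ (Fin 3)) :
    ‖curl ξ x‖ ≤ 288 * Cg * K / ε := by
  have h1 := norm_curl_testField_le hγ hF hFs hξ x
  have h2 : ∫ s in Ico 0 L, ‖fderiv ℝ F (x - γ s)‖ ≤ Cg * (48 * K / ε) := by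
    calc ∫ s in Ico 0 L, ‖fderiv ℝ F (x - γ s)‖
        ≤ ∫ s in Ico 0 L, Cg * ((max ε ‖x - γ s‖)⁻¹) ^ 2 := by
          refine integral_mono_of_nonneg (ae_of_all _ fun _ => norm_nonneg _) ?_
            (ae_of_all _ fun s => hgrad _)
          refine Integrable.const_mul ?_ Cg
          refine Integrable.of_bound ?_ (ε⁻¹ ^ 2) (ae_of_all _ fun s => ?_)
          · exact (((continuous_const.max (continuous_const.sub hγ.lipschitz.continuous).norm).inv₀
              (fun s => (lt_max_of_lt_left hε).ne')).pow 2).aestronglyMeasurable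
          · show ‖((max ε ‖x - γ s‖)⁻¹) ^ 2‖ ≤ ε⁻¹ ^ 2
            rw [Real.norm_eq_abs, abs_of_nonneg (by positivity)]
            gcongr
            exact le_max_left _ _
      _ = Cg * ∫ s in Ico 0 L, ((max ε ‖x - γ s‖)⁻¹) ^ 2 := integral_const_mul _ _
      _ ≤ Cg * (48 * K / ε) := mul_le_mul_of_nonneg_left (hγ.integral_inv_sq_le hK hε x) hCg
  calc ‖curl ξ x‖ ≤ 6 * ∫ s in Ico 0 L, ‖fderiv ℝ F (x - γ s)‖ := h1
    _ ≤ 6 * (Cg * (48 * K / ε)) := by gcongr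
    _ = 288 * Cg * K / ε := by ring

/-- **Small-translation bound for the test field.** With the same kernel,
`|ξ(c + z) − ξ(c)| ≤ 192 C_g K` whenever `|z| ≤ ε`: by the mean value inequality for `F` on the
ball `B(c − γ(s), ε)` (where `|∇F| ≤ 4C_g/max(ε, |c − γ(s)|)²`) and layer cake (a). [cite: JerrardSeis2016, §4.3 (analogue of the flat-norm duality step)] -/
theorem norm_testField_sub_le (hγ : IsArclengthLoop L γ) {K : ℝ≥0}
    (hK : weakL1Norm L (kappaStar L γ) ≤ K) {ε Cg : ℝ} (hε : 0 < ε) (hCg : 0 ≤ Cg)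
    {F : EuclideanSpace ℝ (Fin 3) → ℝ} (hF : ContDiff ℝ 1 F) (hFs : HasCompactSupport F)
    (hgrad : ∀ z, ‖fderiv ℝ F z‖ ≤ Cg * ((max ε ‖z‖)⁻¹) ^ 2)
    {ξ : EuclideanSpace ℝ (Fin 3) → EuclideanSpace ℝ (Fin 3)}
    (hξ : ξ = fun x => ∫ s in Ico 0 L, F (x - γ s) • deriv γ s) (c z : EuclideanSpace ℝ (Fin 3))
    (hz : ‖z‖ ≤ ε) :
    ‖ξ (c + z) - ξ c‖ ≤ 192 * Cg * K := by
  have hFc := hF.continuous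
  -- pointwise mean-value bound
  have hmv : ∀ s, |F (c + z - γ s) - F (c - γ s)| ≤ 4 * Cg * ((max ε ‖c - γ s‖)⁻¹) ^ 2 * ε := by
    intro s
    set w₀ := c - γ s with hw₀
    have hm : 0 < max ε ‖w₀‖ := lt_max_of_lt_left hε
    have hball : ∀ w ∈ closedBall w₀ ε, ‖fderiv ℝ F w‖ ≤ 4 * Cg * ((max ε ‖w₀‖)⁻¹) ^ 2 := by
      intro w hw
      rw [mem_closedBall, dist_eq_norm] at hw
      refine (hgrad w).trans ?_
      have hkey : max ε ‖w₀‖ ≤ 2 * max ε ‖w‖ := by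
        rcases le_or_gt ‖w₀‖ (2 * ε) with h | h
        · calc max ε ‖w₀‖ ≤ 2 * ε := max_le (by linarith) h
            _ ≤ 2 * max ε ‖w‖ := by gcongr; exact le_max_left _ _
        · have : ‖w₀‖ - ε ≤ ‖w‖ := by
            have := norm_sub_norm_le w₀ w
            rw [← norm_neg (w₀ - w), neg_sub] at this
            linarith
          calc max ε ‖w₀‖ = ‖w₀‖ := max_eq_right (by linarith)
            _ ≤ 2 * ‖w‖ := by linarith
            _ ≤ 2 * max ε ‖w‖ := by gcongr; exact le_max_right _ _
      have hm' : 0 < max ε ‖w‖ := lt_max_of_lt_left hε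
      calc Cg * ((max ε ‖w‖)⁻¹) ^ 2 ≤ Cg * ((2 * (max ε ‖w₀‖)⁻¹)) ^ 2 := by
            gcongr
            rw [le_mul_inv_iff₀ hm, inv_mul_le_iff₀ hm']
            linarith
        _ = 4 * Cg * ((max ε ‖w₀‖)⁻¹) ^ 2 := by ring
    have hconv := convex_closedBall w₀ ε
    have h := hconv.norm_image_sub_le_of_norm_fderiv_le (𝕜 := ℝ) (f := F)
      (fun w _ => (hF.differentiable one_ne_zero) w) hball
      (mem_closedBall_self hε.le) (y := w₀ + z)
      (by rw [mem_closedBall, dist_eq_norm, add_sub_cancel_left]; exact hz)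
    rw [add_sub_cancel_left, Real.norm_eq_abs] at h
    have : c + z - γ s = w₀ + z := by rw [hw₀]; abel
    rw [this]
    calc |F (w₀ + z) - F w₀| ≤ 4 * Cg * ((max ε ‖w₀‖)⁻¹) ^ 2 * ‖z‖ := h
      _ ≤ 4 * Cg * ((max ε ‖w₀‖)⁻¹) ^ 2 * ε := by gcongr
  -- integrate
  have hint := integrable_testField_integrand hγ hFc hFs
  have hsub : ξ (c + z) - ξ c =
      ∫ s in Ico 0 L, (F (c + z - γ s) - F (c - γ s)) • deriv γ s := by
    rw [hξ]
    simp only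
    rw [← integral_sub (hint (c + z)) (hint c)]
    congr 1; funext s; rw [sub_smul]
  rw [hsub]
  have hmeas : AEStronglyMeasurable (fun s => ((max ε ‖c - γ s‖)⁻¹) ^ 2)
      (volume.restrict (Ico 0 L)) :=
    (((continuous_const.max (continuous_const.sub hγ.lipschitz.continuous).norm).inv₀
      (fun s => (lt_max_of_lt_left hε).ne')).pow 2).aestronglyMeasurable
  calc ‖∫ s in Ico 0 L, (F (c + z - γ s) - F (c - γ s)) • deriv γ s‖
      ≤ ∫ s in Ico 0 L, ‖(F (c + z - γ s) - F (c - γ s)) • deriv γ s‖ :=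
        norm_integral_le_integral_norm _
    _ ≤ ∫ s in Ico 0 L, 4 * Cg * ε * ((max ε ‖c - γ s‖)⁻¹) ^ 2 := by
        refine integral_mono_of_nonneg (ae_of_all _ fun _ => norm_nonneg _) ?_
          (ae_of_all _ fun s => ?_)
        · refine Integrable.const_mul ?_ _
          refine Integrable.of_bound hmeas (ε⁻¹ ^ 2) (ae_of_all _ fun s => ?_)
          show ‖((max ε ‖c - γ s‖)⁻¹) ^ 2‖ ≤ ε⁻¹ ^ 2
          rw [Real.norm_eq_abs, abs_of_nonneg (by positivity)]
          gcongr
          exact le_max_left _ _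
        · show ‖(F (c + z - γ s) - F (c - γ s)) • deriv γ s‖ ≤ 4 * Cg * ε * ((max ε ‖c - γ s‖)⁻¹) ^ 2
          rw [norm_smul, Real.norm_eq_abs]
          calc |F (c + z - γ s) - F (c - γ s)| * ‖deriv γ s‖
              ≤ 4 * Cg * ((max ε ‖c - γ s‖)⁻¹) ^ 2 * ε * 1 :=
                mul_le_mul (hmv s) (hγ.norm_deriv_le_one s) (norm_nonneg _) (by positivity)
            _ = 4 * Cg * ε * ((max ε ‖c - γ s‖)⁻¹) ^ 2 := by ring
    _ = 4 * Cg * ε * ∫ s in Ico 0 L, ((max ε ‖c - γ s‖)⁻¹) ^ 2 := integral_const_mul _ _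
    _ ≤ 4 * Cg * ε * (48 * K / ε) := by
        gcongr; exact hγ.integral_inv_sq_le hK hε c
    _ = 192 * Cg * K := by field_simp; ring

end TestField

end VortexFilament

end Literature.Analysis.FluidPDE
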